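import Summits.CriticalPhenomena.SAWScalingLimit.Theorems.SAWCompassLatticeSurfaceUniversalityApproxDefs
import Summits.CriticalPhenomena.SAWScalingLimit.Theorems.SAWCompassLatticeSurfaceUniversalityPlusNonVacuity

/-!
# The face side: stub `stub_faceSide` (line `registered`, skeleton v6) of the crux
# `SAWCompassLattice.SurfaceUniversality` (stmt-CriticalPhenomena-6964)

Route `SAWCompassLattice` (sub-problem `SAWScalingLimit`). A port endpoint approximation `(a', b')` of a
Dobrushin domain `D` at `Θ ≡ π/2` (`IsYBEndpointApprox rightAngles D a' b'`) is a PINNED ENDPOINT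
APPROXIMATION for the face rule `faceRule`, and for all small `δ > 0` the plus law `plusLaw D δ (a' δ) (b' δ)`
IS the critical plus path law through the face support `probeSupport faceRule D δ`:

* `inr_mem_faceSupport_iff`, `inl_mem_faceSupport_iff` — the face rule keeps the centre of the face `f`
  iff `f ∈ meshFaces (π/2) D δ`, and the port `e` iff one of the two faces bordering `e` is a mesh face
  (the probes are translates of the re-centred closed unit square `centredSquare`; the closed square of
  the face `f` is the translate of that of the face `(0, 0)` by `planeCorner f + i/2`,
  `rhombus_rightAngles_eq_vadd`);
* `forall_mem_support_iff` — between DISTINCT ports, a plus walk lies in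
  `inFaces (meshFaces (π/2) D δ)` (all ports, centres of mesh faces) iff it lies in the face support:
  every port of the walk is entered (or, for the start, left) through the centre of a mesh face having
  it as a side (`plus_port_mem_of_mem_support`, applied to the walk and to its reverse);
* `pathMeasure_congr_support`, `pathLaw_congr_support` — two vertex sets admitting the same
  self-avoiding paths between `u` and `v` give the same `PortGadget.pathMeasure` / `pathLaw`
  (reindexing `Measure.sum` along `Equiv.subtypeEquivRight`), whence `plusLaw_eq_plusPathLaw_faceRule`;
* `eventually_ne_ports` — the two ports are eventually distinct (their rescaled midpoints tend to the
  distinct marked points), and a Yang–Baxter walk of `D_δ` gives a self-avoiding plus path through the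
  mesh faces (`nonempty_plusPaths_of_ybWalk`), hence through the face support (`plusJoinable`);
* the drawn ports ARE the rescaled midpoints (`PortGadget.embed plusPos (inl e) = planeMidpoint (π/2) e`,
  `rfl`), so the two convergences are `IsYBEndpointApprox.tendsto_fst/snd`.

Tagged [folklore] (bookkeeping on the tree's own objects).
-/

noncomputable section

namespace Summit.CriticalPhenomena.SAWScalingLimit.Theorems.SurfaceUniversality

open MeasureTheory Filter Topology Set Metric
open scoped NNReal ENNReal BoundedContinuousFunction Pointwise
open Literature.Probability.RandomPlanarGeometry Literature.Probability.RandomPlanarGeometry.SAW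
  Literature.Probability.RandomPlanarGeometry.SAW.YangBaxter
open Literature.Probability.LatticeModels (Site)
open Summit.CriticalPhenomena.SAWScalingLimit.Cruxes.HexTransfer.Sketch.Surface (planeCorner_rightAngles
  colShift_rightAngles)
open Complex (I)

/-! ### The face support: centres of mesh faces and the ports on their sides -/

/-- At right angles the closed square of the face `f` is the translate by `planeCorner f + i/2` of the
closed square `[0, 1] × [-1/2, 1/2]` of the face `(0, 0)`. [folklore] -/
theorem rhombus_rightAngles_eq_vadd (f : Face) :
    rhombus rightAngles f =
      (planeCorner rightAngles f + I / 2) +ᵥ rhombus rightAngles ((0 : ℤ), (0 : ℤ)) := by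
  rw [rhombus, rhombus, ← convexHull_vadd]
  congr 1
  have h0 : planeCorner rightAngles ((0 : ℤ), (0 : ℤ)) = -(I / 2) := by
    rw [planeCorner_rightAngles]
    push_cast
    ring
  simp only [cornerSet, Set.vadd_set_insert, Set.vadd_set_singleton, vadd_eq_add,
    colShift_rightAngles, h0]
  congr 1
  · ring
  congr 1
  · ring
  congr 1
  · ring
  congr 1
  ring

/-- Testing the rescaled translate by `planeCorner f + i/2` of the closed square of the face `(0, 0)`
pointwise for membership in `Ω` is testing `f ∈ meshFaces (π/2) Ω δ`. [folklore] -/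
theorem forall_rhombus_zero_iff {Ω : Set ℂ} {δ : ℝ} (f : Face) {g : ℂ → ℂ}
    (hg : ∀ w, g w = (δ : ℂ) * (planeCorner rightAngles f + I / 2 + w)) :
    (∀ ⦃w : ℂ⦄, w ∈ rhombus rightAngles ((0 : ℤ), (0 : ℤ)) → g w ∈ Ω) ↔
      f ∈ meshFaces rightAngles Ω δ := by
  rw [mem_meshFaces_iff, rhombus_rightAngles_eq_vadd f, ← Set.image_vadd, Set.forall_mem_image]
  simp only [hg, vadd_eq_add]

/-- **The face rule keeps the centre of `f` iff `f` is a mesh face.** [folklore] -/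
theorem inr_mem_faceSupport_iff {Ω : Set ℂ} {δ : ℝ} {f : Face} {u : Unit} :
    (Sum.inr (f, u) : PVert) ∈ probeSupport faceRule Ω δ ↔ f ∈ meshFaces rightAngles Ω δ := by
  rw [mem_probeSupport_iff]
  simp only [ProbeRule.probesAt_inr, faceRule, List.mem_singleton, exists_eq_left, probeTarget,
    centredSquare, Set.forall_mem_image]
  exact forall_rhombus_zero_iff f fun w => by
    simp only [PortGadget.embed, plusPos]
    ring

/-- **The face rule keeps the port `e` iff one of the two faces bordering `e` is a mesh face.**
[folklore] -/
theorem inl_mem_faceSupport_iff {Ω : Set ℂ} {δ : ℝ} {e : MidEdge} :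
    (Sum.inl e : PVert) ∈ probeSupport faceRule Ω δ ↔
      e.faces.1 ∈ meshFaces rightAngles Ω δ ∨ e.faces.2 ∈ meshFaces rightAngles Ω δ := by
  rw [mem_probeSupport_iff]
  cases e with
  | vert k j =>
    simp only [ProbeRule.probesAt_vert, faceRule, List.mem_cons, List.not_mem_nil, or_false,
      exists_eq_or_imp, exists_eq_left, probeTarget, centredSquare, Set.forall_mem_image,
      MidEdge.faces]
    exact or_congr
      (forall_rhombus_zero_iff (k - 1, j) fun w => by
        simp only [PortGadget.embed, planeMidpoint, planeCorner_rightAngles]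
        push_cast
        ring)
      (forall_rhombus_zero_iff (k, j) fun w => by
        simp only [PortGadget.embed, planeMidpoint, planeCorner_rightAngles]
        ring)
  | slant k j =>
    simp only [ProbeRule.probesAt_slant, faceRule, List.mem_cons, List.not_mem_nil, or_false,
      exists_eq_or_imp, exists_eq_left, probeTarget, centredSquare, Set.forall_mem_image,
      MidEdge.faces]
    exact or_congr
      (forall_rhombus_zero_iff (k, j - 1) fun w => by
        simp only [PortGadget.embed, planeMidpoint, planeCorner_rightAngles, colShift_rightAngles]
        push_cast
        ring)
      (forall_rhombus_zero_iff (k, j) fun w => by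
        simp only [PortGadget.embed, planeMidpoint, planeCorner_rightAngles, colShift_rightAngles]
        ring)

/-- The face support lies in `inFaces (meshFaces (π/2) Ω δ)` (its centres are centres of mesh faces;
every port is in `inFaces`). [folklore] -/
theorem faceSupport_subset_inFaces {Ω : Set ℂ} {δ : ℝ} :
    probeSupport faceRule Ω δ ⊆ PortGadget.inFaces (meshFaces rightAngles Ω δ) := by
  rintro (e | ⟨f, u⟩) h
  · exact PortGadget.inl_mem_inFaces _ e
  · exact (PortGadget.inr_mem_inFaces _ f u).2 (inr_mem_faceSupport_iff.1 h)

/-- A face having `e` as a side is one of the two faces bordering `e`. [folklore] -/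
theorem faces_mem_of_side_eq {F : Set Face} {f : Face} (hf : f ∈ F) {s : Side} {e : MidEdge}
    (hs : f.side s = e) : e.faces.1 ∈ F ∨ e.faces.2 ∈ F := by
  rcases (Face.exists_side_eq_iff f e).1 ⟨s, hs⟩ with rfl | rfl
  exacts [Or.inl hf, Or.inr hf]

/-! ### Plus walks through the mesh faces are the plus walks through the face support -/

/-- **Between DISTINCT ports, a plus walk lies in `inFaces (meshFaces (π/2) Ω δ)` iff it lies in the
face support**: every port of the walk other than its start is entered from the centre of a mesh face
having it as a side, and the start is left towards one (apply the same to the reversed walk, whose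
start is the other port). [folklore] -/
theorem forall_mem_support_iff {Ω : Set ℂ} {δ : ℝ} {a b : MidEdge} (hab : a ≠ b)
    (p : plusLattice.Walk (Sum.inl a : PVert) (Sum.inl b)) :
    (∀ x ∈ p.support, x ∈ PortGadget.inFaces (meshFaces rightAngles Ω δ)) ↔
      ∀ x ∈ p.support, x ∈ probeSupport faceRule Ω δ := by
  refine ⟨fun hS x hx => ?_, fun hS x hx => faceSupport_subset_inFaces (hS x hx)⟩
  rcases x with e | ⟨f, u⟩
  · rw [inl_mem_faceSupport_iff]
    by_cases hea : e = a
    · subst hea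
      have hS' : ∀ x ∈ p.reverse.support, x ∈ PortGadget.inFaces (meshFaces rightAngles Ω δ) := by
        intro x hx'
        rw [SimpleGraph.Walk.support_reverse, List.mem_reverse] at hx'
        exact hS x hx'
      have hx' : (Sum.inl e : PVert) ∈ p.reverse.support := by
        rw [SimpleGraph.Walk.support_reverse, List.mem_reverse]
        exact hx
      obtain ⟨f, hf, s, hs⟩ :=
        plus_port_mem_of_mem_support p.reverse hS' hx' fun h => hab (Sum.inl_injective h)
      exact faces_mem_of_side_eq hf hs
    · obtain ⟨f, hf, s, hs⟩ :=
        plus_port_mem_of_mem_support p hS hx fun h => hea (Sum.inl_injective h)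
      exact faces_mem_of_side_eq hf hs
  · exact inr_mem_faceSupport_iff.2 ((PortGadget.inr_mem_inFaces _ f u).1 (hS _ hx))

/-! ### Path laws with the same admissible paths agree -/

/-- Two vertex sets admitting the same self-avoiding paths from `u` to `v` give the same weighted path
measure (reindex the `Measure.sum` along the identity of the underlying paths). [folklore] -/
theorem pathMeasure_congr_support {V : Type*} {G : SimpleGraph V} {y : V → V → ℝ} {emb : V → ℂ}
    {S S' : Set V} {δ : ℝ} {u v : V}
    (h : ∀ p : G.Walk u v, p.IsPath → ((∀ x ∈ p.support, x ∈ S) ↔ ∀ x ∈ p.support, x ∈ S')) :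
    PortGadget.pathMeasure G y emb S δ u v = PortGadget.pathMeasure G y emb S' δ u v := by
  unfold PortGadget.pathMeasure
  rw [← Measure.sum_comp_equiv (Equiv.subtypeEquivRight fun p => and_congr_right (h p))]
  rfl

/-- Two vertex sets admitting the same self-avoiding paths from `u` to `v` give the same path law.
[folklore] -/
theorem pathLaw_congr_support {V : Type*} {G : SimpleGraph V} {y : V → V → ℝ} {emb : V → ℂ}
    {S S' : Set V} {δ : ℝ} {u v : V}
    (h : ∀ p : G.Walk u v, p.IsPath → ((∀ x ∈ p.support, x ∈ S) ↔ ∀ x ∈ p.support, x ∈ S')) :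
    PortGadget.pathLaw G y emb S δ u v = PortGadget.pathLaw G y emb S' δ u v := by
  unfold PortGadget.pathLaw
  rw [pathMeasure_congr_support h]

/-- **Between distinct ports the plus law of `Ω_δ` is the plus path law through the face support.**
[folklore] -/
theorem plusLaw_eq_plusPathLaw_faceRule {Ω : Set ℂ} {δ : ℝ} {a b : MidEdge} (hab : a ≠ b) :
    plusLaw Ω δ a b = plusPathLaw (probeSupport faceRule Ω δ) δ (Sum.inl a) (Sum.inl b) := by
  rw [plusLaw_eq_plusPathLaw]
  unfold plusPathLaw
  exact pathLaw_congr_support fun p _ => forall_mem_support_iff hab p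

/-! ### Along `δ → 0⁺` -/

/-- Under a port endpoint approximation the two ports are eventually distinct along `δ → 0⁺` (their
rescaled midpoints tend to the distinct marked points). [folklore] -/
theorem eventually_ne_ports {D : DobrushinDomain} {a b : ℝ → MidEdge}
    (h : IsYBEndpointApprox rightAngles D a b) : ∀ᶠ δ in 𝓝[>] (0 : ℝ), a δ ≠ b δ := by
  have hpt : D.pt 0 ≠ D.pt 1 := fun h => absurd (D.pt_injective h) (by decide)
  obtain ⟨U, V, hU, hV, h0, h1, hUV⟩ := t2_separation hpt
  filter_upwards [h.tendsto_fst (hU.mem_nhds h0), h.tendsto_snd (hV.mem_nhds h1)]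
    with δ hδ0 hδ1 heq
  have h0' : (δ : ℂ) * planeMidpoint rightAngles (a δ) ∈ U := hδ0
  have h1' : (δ : ℂ) * planeMidpoint rightAngles (b δ) ∈ V := hδ1
  rw [heq] at h0'
  exact Set.disjoint_left.1 hUV h0' h1'

/-- Under a port endpoint approximation, eventually the plus law is the plus path law through the face
support. [folklore] -/
theorem eventually_plusLaw_eq_plusPathLaw_faceRule {D : DobrushinDomain} {a b : ℝ → MidEdge}
    (h : IsYBEndpointApprox rightAngles D a b) :
    ∀ᶠ δ in 𝓝[>] (0 : ℝ), plusLaw D.carrier δ (a δ) (b δ) =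
      plusPathLaw (probeSupport faceRule D.carrier δ) δ (Sum.inl (a δ)) (Sum.inl (b δ)) := by
  filter_upwards [eventually_ne_ports h] with δ hne
  exact plusLaw_eq_plusPathLaw_faceRule hne

/-- Under a port endpoint approximation, eventually the two ports are joined by a self-avoiding plus
path through the face support (a Yang–Baxter walk of `D_δ` gives a plus path through the mesh faces).
[folklore] -/
theorem eventually_mem_plusJoinable_faceRule {D : DobrushinDomain} {a b : ℝ → MidEdge}
    (h : IsYBEndpointApprox rightAngles D a b) :
    ∀ᶠ δ in 𝓝[>] (0 : ℝ), ((Sum.inl (a δ) : PVert), (Sum.inl (b δ) : PVert)) ∈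
      plusJoinable (probeSupport faceRule D.carrier δ) := by
  filter_upwards [eventually_ne_ports h, h.nonempty] with δ hne hγ
  obtain ⟨γ⟩ := hγ
  obtain ⟨⟨p, hp, hS⟩⟩ := nonempty_plusPaths_of_ybWalk γ
  exact mem_plusJoinable_iff.2 ⟨p, hp, (forall_mem_support_iff hne p).1 hS⟩

/-- Stub `stub_faceSide` of the line `registered` (skeleton v6), crux `SAWCompassLattice.SurfaceUniversality`
(stmt-CriticalPhenomena-6964): **a port endpoint approximation at `Θ ≡ π/2` is a pinned endpoint
approximation for the face rule, and eventually the plus law of `D_δ` IS the plus path law through the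
face support** (eventually `plusLaw = plusPathLaw (probeSupport faceRule …)`; eventually joined through
the face support; the drawn ports converge to the marked points). [folklore] -/
theorem stub_faceSide : ∀ (D : DobrushinDomain) (a' b' : ℝ → MidEdge), IsYBEndpointApprox rightAngles D a' b' → (∀ᶠ δ in 𝓝[>] (0 : ℝ), plusLaw D.carrier δ (a' δ) (b' δ) = plusPathLaw (probeSupport faceRule D.carrier δ) δ (Sum.inl (a' δ)) (Sum.inl (b' δ))) ∧ (∀ᶠ δ in 𝓝[>] (0 : ℝ), ((Sum.inl (a' δ) : PVert), (Sum.inl (b' δ) : PVert)) ∈ plusJoinable (probeSupport faceRule D.carrier δ)) ∧ Tendsto (fun δ : ℝ => (δ : ℂ) * PortGadget.embed plusPos (Sum.inl (a' δ) : PVert)) (𝓝[>] (0 : ℝ)) (𝓝 (D.pt 0)) ∧ Tendsto (fun δ : ℝ => (δ : ℂ) * PortGadget.embed plusPos (Sum.inl (b' δ) : PVert)) (𝓝[>] (0 : ℝ)) (𝓝 (D.pt 1)) :=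
  fun _ _ _ h => ⟨eventually_plusLaw_eq_plusPathLaw_faceRule h, eventually_mem_plusJoinable_faceRule h,
    h.tendsto_fst, h.tendsto_snd⟩

end Summit.CriticalPhenomena.SAWScalingLimit.Theorems.SurfaceUniversality

end
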